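import Summits.BirchSwinnertonDyer.BirchSwinnertonDyer.Theorems.TwoAdicConverseGoodTwistsKolyvaginBigImageLeaf
import Summits.BirchSwinnertonDyer.BirchSwinnertonDyer.Theorems.GenusKolyvaginAtTwoMinimalTwinBSDTwoBridges
import Summits.BirchSwinnertonDyer.BirchSwinnertonDyer.Theorems.ByReductionTypeAtTwoSupersingularColemanClassKit
import Summits.BirchSwinnertonDyer.Rank1Residual.X5.TwoAdicImageCertificates
import HarnessLib

/-!
# Route `TwoAdicConverse` (rung S3): CLASS KIT for the Kolyvagin-at-`2` road on the big-image habitat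
# — one-line class rows from kernel-decided curve data

Cell `bsd-2adic` (run/shared/lean/pub/bsd-2adic/), seat `bsd-2adic-conv-1` GEN 17, file F4 (kit for the class
batches `TwoAdicConverseKolyvaginBigImageResidue*`; roads F1 p607060 / F2 p607992 / F3
`TwoAdicConverseGoodTwistsKolyvaginBigImageLeaf`). THEOREMS ONLY — no named fact, no axiom, no definition.

A census class of the cell (an X5@2 good-ordinary class, Cremona label, distinguished member `W`) enters
the Kolyvagin road through THREE kernel-decided data: `GoodOrd W 2` (point count mod `2`), `¬ W.HasCM`
(`j(W) ∉` the thirteen rational CM `j`-invariants — tree THEOREM `WeierstrassCurve.hasCM_iff_j_mem_holds`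
through the landed `SSColemanRoad.not_hasCM_of_j_eq_of_not_mem`, imported) and `TwoAdicSurjective W` (the four Dokchitser–Dokchitser
certificates of `X5/TwoAdicImageCertificates.lean`, unconditional since
`DokchitserDokchitser2012_surjective_mod_two_four_eight_holds`). This kit converts the X5 currency
`TwoAdicSurjective W = ∀ n > 0, ρ̄_{W,(2:ℤ)^n}` onto into the route's binder `∀ m, ρ̄_{W,((2^m:ℕ):ℤ)}` onto
(`forall_hasSurjectiveModNGaloisRep_two_pow_of_twoAdicSurjective` = the landed
`MinimalTwinBSDTwo.forall_hasSurjectiveModNGaloisRep_two_pow_of_pos`, imported — level `1` is the trivial group) and states the two CLASS DOORS: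

* `analyticRank_eq_of_selmerCorank_eq_of_twoAdicSurjective` — the rung leaf AT the curve (`r ≤ 1`:
  `corank_{ℤ₂} Sel_{2^∞}(W/ℚ) = r ⟹ ord_{s=1} L(W, s) = r`) from V1′ (item 24622) + V2♭ (item 24623) +
  `NoTwoTorsionOverK` (item 24405, proved) + `PrintedInputsRankOneAtTwo` (item 23951) + BFH + GZK;
* `bsdRank_and_goldfeld_goodTwists_of_twoAdicSurjective` — LADDER-BSD §1 row S3's head line for the
  curve's good twist family `𝓕 = {d square-free, d ≡ 1 (mod 4)}` (rank BSD for `100 %` of `𝓕`, Goldfeld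
  `50 / 50` with BSD), the same inputs + Smith's Thm. 1.1 for `W`.

HONEST FRAMING. The doors DISPLAY the two OPEN Kolyvagin-at-`2` cruxes of the route (by name) and the
PRINT supports; a class row obtained from them is a class-level theorem MODULO those research binders —
species «BY NAME (24622 + 24623)» in the cell's S3 census, not «KATO-FREE». Nothing is booked; BSD is not
proved by any of this. PARTITION (D-0054): none — RANK axis (S3) × X5@2 good-ord big-image classes;
types-the-object-of; closes none.

References: T. Dokchitser, V. Dokchitser, Math. Z. 272 (2012), Theorem [DokchitserDokchitserMathZ2012];
J. H. Silverman, *AEC* (2009), App. C §11 [SilvermanAEC2009]; A. Smith, arXiv:2503.17619, Thm. 1.1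
[arXiv250317619]; W. Zhang, Camb. J. Math. 2 (2014), Thm. 1.1 [WZhang2014].
-/

set_option linter.dupNamespace false
set_option autoImplicit false

noncomputable section

open scoped Classical

open Filter Topology WeierstrassCurve Literature Literature.NumberTheory.EllipticCurves
  Literature.NumberTheory.EllipticCurves.ModularForms
  Literature.NumberTheory.EllipticCurves.Rank1Residual
  Summit.BirchSwinnertonDyer.BirchSwinnertonDyer.Theses.TwoAdicConverse
  Summit.BirchSwinnertonDyer.BirchSwinnertonDyer.Theorems.TwoAdicKolyvaginRankZero
  Summit.BirchSwinnertonDyer.Rank1Residual.X5 Summit.BirchSwinnertonDyer.Rank1Residual.X5.O1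

namespace Summit.BirchSwinnertonDyer.BirchSwinnertonDyer.Theorems.TwoAdicKolyvaginGoodTwists

/-! ## §1 Currency exchange: `TwoAdicSurjective` ⟹ the route's binder `∀ m, ρ̄_{W,2^m}` onto -/

/-- **The X5 binder `TwoAdicSurjective W` (`∀ n > 0, ρ̄_{W,(2:ℤ)^n}` onto) gives the route's binder
`∀ m, ρ̄_{W,((2^m : ℕ) : ℤ)}` onto** (`m = 0`: the trivial level; `m ≥ 1`: `Nat.cast_pow`) — the landed bridge of route GenusKolyvaginAtTwo's
`MinimalTwinBSDTwoBridges`, re-exported under the X5 name. [folklore] -/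
theorem forall_hasSurjectiveModNGaloisRep_two_pow_of_twoAdicSurjective (W : WeierstrassCurve ℚ)
    (h : TwoAdicSurjective W) : ∀ m : ℕ, W.HasSurjectiveModNGaloisRep (2 ^ m : ℕ) :=
  MinimalTwinBSDTwo.forall_hasSurjectiveModNGaloisRep_two_pow_of_pos W h

/-! ## §2 The class doors -/

/-- **CLASS DOOR 1 — the rung leaf AT a big-image curve, from Kolyvagin at `2`.** For `W/ℚ` globally
minimal with kernel-decided `¬ CM`, `GoodOrd W 2 ∨ Mult W 2` and `TwoAdicSurjective W`: for `r ≤ 1`,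
`corank_{ℤ₂} Sel_{2^∞}(W/ℚ) = r ⟹ ord_{s=1} L(W, s) = r`, displayed on V1′ + V2♭ + `NoTwoTorsionOverK` +
`PrintedInputsRankOneAtTwo` + BFH + GZK (F1 `nonCMTwoConverse_bigImage_of_kolyvaginAtTwo`).
[cite: WZhang2014, Thm. 1.1 (shape at p ≥ 5)] [cite: DokchitserDokchitserMathZ2012, Theorem (p. 961)] -/
theorem analyticRank_eq_of_selmerCorank_eq_of_twoAdicSurjective
    (hV1 : KolyvaginNonvanishingAtTwoFrame) (hV2 : KolyvaginCorankLowerBoundAtTwo)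
    (hT : NoTwoTorsionOverK) (hIn : PrintedInputsRankOneAtTwo)
    (hBFH : bumpFriedbergHoffstein_exists_heegnerField_split_twist_simpleZero)
    (hGZK : rank_eq_analyticRank_of_analyticRank_le_one)
    (W : WeierstrassCurve ℚ) [W.IsElliptic] [W.IsGloballyMinimal] (hCM : ¬ W.HasCM)
    (hred : GoodOrd W 2 ∨ Mult W 2) (h2 : TwoAdicSurjective W)
    (r : ℕ) (hr : r ≤ 1) (hc : W.selmerCorank 2 = r) : W.analyticRank = r :=
  nonCMTwoConverse_bigImage_of_kolyvaginAtTwo hV1 hV2 hT hIn hBFH hGZK W hCM hred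
    (forall_hasSurjectiveModNGaloisRep_two_pow_of_twoAdicSurjective W h2) r hr hc

/-- **CLASS DOOR 2 — LADDER-BSD §1 row S3's head line for the good twist family of a big-image curve,
from Kolyvagin at `2`.** Same data + Smith's Thm. 1.1 for `W`: rank BSD (`ord_{s=1} L = rank`, `Ш` finite)
for `100 %` of `d ∈ 𝓕` and Goldfeld's `50 / 50` with BSD in `𝓕` (F3
`bsdRank_and_goldfeld_goodTwists_leafHabitat_of_kolyvaginAtTwo`). [cite: arXiv250317619, Thm. 1.1 and Cor. 1.2]
[cite: WZhang2014, Thm. 1.1 (shape)] [cite: MurtyMurty1997, Ch. 6 §1] -/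
theorem bsdRank_and_goldfeld_goodTwists_of_twoAdicSurjective
    (hV1 : KolyvaginNonvanishingAtTwoFrame) (hV2 : KolyvaginCorankLowerBoundAtTwo)
    (hT : NoTwoTorsionOverK) (hIn : PrintedInputsRankOneAtTwo)
    (hBFH : bumpFriedbergHoffstein_exists_heegnerField_split_twist_simpleZero)
    (hGZK : rank_eq_analyticRank_of_analyticRank_le_one)
    (W : WeierstrassCurve ℚ) [W.IsElliptic] [W.IsGloballyMinimal] (hCM : ¬ W.HasCM)
    (hred : GoodOrd W 2 ∨ Mult W 2) (h2 : TwoAdicSurjective W) (hS : smith_selmerCorank_density W) :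
    Tendsto (fun X : ℕ ↦ (Nat.card {d : ℤ | Squarefree d ∧ |d| ≤ (X : ℤ) ∧ (d % 4 = 1 ∧
        ((W.quadraticTwist d).analyticRank = (W.quadraticTwist d).mordellWeilRank ∧
          Finite (W.quadraticTwist d).sha))} : ℝ) /
      Nat.card {d : ℤ | Squarefree d ∧ |d| ≤ (X : ℤ) ∧ d % 4 = 1}) atTop (𝓝 1) ∧
    Tendsto (fun X : ℕ ↦ (Nat.card {d : ℤ | Squarefree d ∧ |d| ≤ (X : ℤ) ∧ (d % 4 = 1 ∧
        ((W.quadraticTwist d).analyticRank = 0 ∧ (W.quadraticTwist d).mordellWeilRank = 0 ∧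
          Finite (W.quadraticTwist d).sha))} : ℝ) /
      Nat.card {d : ℤ | Squarefree d ∧ |d| ≤ (X : ℤ) ∧ d % 4 = 1}) atTop (𝓝 (1 / 2)) ∧
    Tendsto (fun X : ℕ ↦ (Nat.card {d : ℤ | Squarefree d ∧ |d| ≤ (X : ℤ) ∧ (d % 4 = 1 ∧
        ((W.quadraticTwist d).analyticRank = 1 ∧ (W.quadraticTwist d).mordellWeilRank = 1 ∧
          Finite (W.quadraticTwist d).sha))} : ℝ) /
      Nat.card {d : ℤ | Squarefree d ∧ |d| ≤ (X : ℤ) ∧ d % 4 = 1}) atTop (𝓝 (1 / 2)) :=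
  bsdRank_and_goldfeld_goodTwists_leafHabitat_of_kolyvaginAtTwo W hV1 hV2 hT hIn hBFH hGZK hCM hred
    (forall_hasSurjectiveModNGaloisRep_two_pow_of_twoAdicSurjective W h2) hS

end Summit.BirchSwinnertonDyer.BirchSwinnertonDyer.Theorems.TwoAdicKolyvaginGoodTwists

end
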